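import Summits.AtomisticToContinuum.BoseEinsteinCondensation.Theses.BECFeynmanVortexArea
import Summits.AtomisticToContinuum.BoseEinsteinCondensation.Theses.BECNoCheapMomentum
import Summits.AtomisticToContinuum.BoseEinsteinCondensation.Theorems.BECConjugateDominationIMUChainGlueEnergy
import Summits.AtomisticToContinuum.BoseEinsteinCondensation.Theorems.PeriodicIRBound.Negative.AeZeroPotential
import Literature.MathematicalPhysics.QuantumManyBody.PeriodicBoseGasMomentumSector
import Literature.MathematicalPhysics.QuantumManyBody.PeriodicBoseGasRelabelling
import HarnessLib

/-!
# The zero-momentum gap at fixed `(N, L)` — item `ZeroMomentumGround`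
# (stmt-AtomisticToContinuum-11845; routes `BECFeynmanVortexArea`, `BECNoCheapMomentum`)

For a repulsive finite-range pair potential `v` with `∫_{ℝ³} v(|x|) dx < ∞`, every `N`, every
`L > 0` and every `q ≠ 0`, the periodic ground-state energy lies STRICTLY below the bottom of the
total-momentum sector `q`:
`E₀^per(N, L) < E^per_N(q; L) = momentumSectorEnergy v N L q`.

The item's informal proof goes through Perron–Frobenius (uniqueness and translation invariance of
the torus ground state, Reed–Simon IV §XIII.12). We prove the statement as filed by an elementary,
operator-free argument which gives the explicit gap `|q|²/N` and needs no boundedness of `v`: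

* **Diamagnetic / centre-of-mass inequality** (`kineticDensity_regMod_add_le`). For a `C¹` Bloch-`q`
  function `Ψ` and `ε > 0` put `Φ_ε = √(|Ψ|² + ε²) − ε` (the regularised modulus: `C¹`, periodic,
  Bose-symmetric, translation invariant, `0 ≤ Φ_ε ≤ |Ψ|`). Pointwise,
  `|∇Ψ|² ≥ |∇Φ_ε|² + (|q|²/N)|Ψ|²`: writing `∂Ψ·Ψ̄ = a + ib` per direction, `|Ψ|²|∂Ψ|² = a² + b²`,
  `|∂Φ_ε|² = a²/(|Ψ|² + ε²) ≤ a²/|Ψ|²`, while the momentum eigenvalue equation `∑ⱼ ∂_{j,α}Ψ = i q_α Ψ`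
  (`HasTotalMomentum.sum_fderiv_apply_single`) gives `∑ⱼ b_{j,α} = q_α|Ψ|²`, whence
  `∑ b² ≥ |q|²|Ψ|⁴/N` by Cauchy–Schwarz (`cm_diamagnetic_alg`).
* Integrating, `⟨Ψ,HΨ⟩ ≥ Q(Φ_ε) + |q|²/N ≥ E₀ · ∫|Φ_ε|² + |q|²/N` (unnormalised variational principle
  `periodicGroundStateEnergy_mul_lintegral_le`), and `∫|Φ_ε|² → 1` as `ε → 0` (dominated
  convergence), so `E^per_N(q;L) ≥ E₀^per(N,L) + |q|²/N` for EVERY `v ≥ 0` and `N ≥ 1`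
  (`periodicGroundStateEnergy_add_le_momentumSectorEnergy`; this is `H ≥ H_rel + P²/(2mN)` read on the
  torus, where only the inequality survives).
* Strictness: `E₀^per(N,L) ≤ C(N,2) L⁻³ ∫v < ∞` by the constant state
  (`IMUChainGlue.periodicGroundStateEnergy_le_pairs`); for `N = 0` the sector `q ≠ 0` is empty
  (`PeriodicIRBound.Negative.momentumSectorEnergy_zero_particles`).

References: H. D. Cornean, J. Dereziński, P. Ziń, J. Math. Phys. 50 (2009) 062103, §2.2 (Galilei
covariance `H = P²/2n + H_rel`); E. H. Lieb, R. Seiringer, J. P. Solovej, J. Yngvason, *The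
Mathematics of the Bose Gas and its Condensation* (2005), Ch. 2 (diamagnetic inequality
`|∇|Ψ|| ≤ |∇Ψ|`).
-/

noncomputable section

open scoped BigOperators ENNReal NNReal ComplexConjugate Topology
open Filter MeasureTheory

namespace Summit.AtomisticToContinuum.BoseEinsteinCondensation.Theorems.ZeroMomentumGround

open Literature.MathematicalPhysics.QuantumManyBody
open Literature.MathematicalPhysics.QuantumManyBody.BoseGas

variable {N : ℕ} {L : ℝ}

/-! ### Pointwise algebra -/

/-- **Pointwise algebra of the diamagnetic / centre-of-mass inequality.** For `z ∈ ℂ` (the value of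
the wave function), `w i a ∈ ℂ` (its partial derivatives) with `∑ᵢ w i a = i qₐ z` (the momentum
eigenvalue equation) and any real `ε`:
`∑ (Re(w·z̄))²/(|z|²+ε²) + (|q|²/N)|z|² ≤ ∑ |w|²`
(split `|z|²|w|² = Re(w z̄)² + Im(w z̄)²`, `∑ᵢ Im(w i a · z̄) = qₐ|z|²`, Cauchy–Schwarz in `i`). [folklore] -/
theorem cm_diamagnetic_alg (hN : 0 < N) (z : ℂ) (w : Fin N → Fin 3 → ℂ) (q : Fin 3 → ℝ)
    (hmom : ∀ a, ∑ i, w i a = (q a : ℂ) * Complex.I * z) (ε : ℝ) :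
    (∑ i, ∑ a, ((w i a * conj z).re) ^ 2) / (‖z‖ ^ 2 + ε ^ 2) + (∑ a, q a ^ 2) / N * ‖z‖ ^ 2 ≤
      ∑ i, ∑ a, ‖w i a‖ ^ 2 := by
  set Sa := ∑ i, ∑ a, ((w i a * conj z).re) ^ 2 with hSa_def
  set Sb := ∑ i, ∑ a, ((w i a * conj z).im) ^ 2 with hSb_def
  set K := ∑ i, ∑ a, ‖w i a‖ ^ 2 with hK_def
  have hSa : 0 ≤ Sa := by positivity
  have hSb : 0 ≤ Sb := by positivity
  have hK : 0 ≤ K := by positivity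
  -- `|z|² |w|² = Re(w z̄)² + Im(w z̄)²`
  have hsplit : ‖z‖ ^ 2 * K = Sa + Sb := by
    simp only [hSa_def, hSb_def, hK_def, Finset.mul_sum, ← Finset.sum_add_distrib]
    refine Finset.sum_congr rfl fun i _ => Finset.sum_congr rfl fun a _ => ?_
    have h : ‖w i a * conj z‖ ^ 2 = (w i a * conj z).re ^ 2 + (w i a * conj z).im ^ 2 := by
      rw [Complex.sq_norm, Complex.normSq_apply]; ring
    rw [← h, norm_mul, Complex.norm_conj]; ring
  -- `∑ᵢ Im(w i a · z̄) = qₐ |z|²`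
  have hIm : ∀ a, ∑ i, (w i a * conj z).im = q a * ‖z‖ ^ 2 := by
    intro a
    rw [← Complex.im_sum, ← Finset.sum_mul, hmom a, mul_assoc, Complex.mul_conj,
      Complex.normSq_eq_norm_sq]
    simp only [Complex.mul_im, Complex.mul_re, Complex.ofReal_re, Complex.ofReal_im,
      Complex.I_re, Complex.I_im]
    ring
  -- Cauchy–Schwarz in `i`
  have hCS : (∑ a, q a ^ 2) * (‖z‖ ^ 2) ^ 2 ≤ N * Sb := by
    rw [hSb_def, Finset.sum_comm, Finset.mul_sum, Finset.sum_mul]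
    refine Finset.sum_le_sum fun a _ => ?_
    calc q a ^ 2 * (‖z‖ ^ 2) ^ 2 = (∑ i, (w i a * conj z).im) ^ 2 := by rw [hIm]; ring
      _ ≤ (Finset.univ : Finset (Fin N)).card * ∑ i, ((w i a * conj z).im) ^ 2 :=
          sq_sum_le_card_mul_sum_sq
      _ = N * ∑ i, ((w i a * conj z).im) ^ 2 := by rw [Finset.card_univ, Fintype.card_fin]
  have hNpos : (0 : ℝ) < N := by exact_mod_cast hN
  rcases eq_or_ne z 0 with hz | hz
  · have hSa0 : Sa = 0 := by simp [hSa_def, hz]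
    rw [hSa0, hz, norm_zero, zero_div, zero_add]
    simpa using hK
  · have hn : 0 < ‖z‖ ^ 2 := by positivity
    have h1 : Sa / (‖z‖ ^ 2 + ε ^ 2) ≤ Sa / ‖z‖ ^ 2 :=
      div_le_div_of_nonneg_left hSa hn (by nlinarith [sq_nonneg ε])
    have h2 : (∑ a, q a ^ 2) / N * ‖z‖ ^ 2 ≤ Sb / ‖z‖ ^ 2 := by
      rw [div_mul_eq_mul_div, div_le_div_iff₀ hNpos hn]
      nlinarith [hCS]
    calc Sa / (‖z‖ ^ 2 + ε ^ 2) + (∑ a, q a ^ 2) / N * ‖z‖ ^ 2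
        ≤ Sa / ‖z‖ ^ 2 + Sb / ‖z‖ ^ 2 := add_le_add h1 h2
      _ = K := by rw [← add_div, ← hsplit]; field_simp

/-- `∑ᵢ ∑ₐ ofReal (f i a) = ofReal (∑ᵢ ∑ₐ f i a)` for non-negative `f`. [folklore] -/
theorem sum_sum_ofReal (f : Fin N → Fin 3 → ℝ) (hf : ∀ i a, 0 ≤ f i a) :
    ∑ i, ∑ a, ENNReal.ofReal (f i a) = ENNReal.ofReal (∑ i, ∑ a, f i a) := by
  rw [ENNReal.ofReal_sum_of_nonneg fun i _ => Finset.sum_nonneg fun a _ => hf i a]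
  exact Finset.sum_congr rfl fun i _ => (ENNReal.ofReal_sum_of_nonneg fun a _ => hf i a).symm

/-! ### The regularised modulus `Φ_ε = √(|ψ|² + ε²) − ε` -/

/-- `Φ_ε` is `C¹` when `ψ` is (`|ψ|²` is `C¹` and `t ↦ √(t + ε²)` is smooth on `t ≥ 0`). [folklore] -/
theorem contDiff_regMod {ψ : Config N → ℂ} (hψ : ContDiff ℝ 1 ψ) {ε : ℝ} (hε : 0 < ε) :
    ContDiff ℝ 1 (fun Y => ((Real.sqrt (‖ψ Y‖ ^ 2 + ε ^ 2) - ε : ℝ) : ℂ)) := by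
  have h1 : ContDiff ℝ 1 fun Y => ‖ψ Y‖ ^ 2 + ε ^ 2 := (hψ.norm_sq ℝ).add contDiff_const
  have h2 : ContDiff ℝ 1 fun Y => Real.sqrt (‖ψ Y‖ ^ 2 + ε ^ 2) :=
    h1.sqrt fun Y => by positivity
  exact Complex.ofRealCLM.contDiff.comp (h2.sub contDiff_const)

/-- `|Φ_ε| = √(|z|² + ε²) − ε ≥ 0`. [folklore] -/
theorem norm_regMod (z : ℂ) (ε : ℝ) :
    ‖(((Real.sqrt (‖z‖ ^ 2 + ε ^ 2) - ε : ℝ) : ℂ))‖ = Real.sqrt (‖z‖ ^ 2 + ε ^ 2) - ε := by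
  rw [Complex.norm_real, Real.norm_of_nonneg]
  rw [sub_nonneg]
  exact Real.le_sqrt_of_sq_le (by nlinarith [sq_nonneg ‖z‖])

/-- `|Φ_ε| ≤ |ψ|` pointwise. [folklore] -/
theorem norm_regMod_le (z : ℂ) {ε : ℝ} (hε : 0 < ε) :
    ‖(((Real.sqrt (‖z‖ ^ 2 + ε ^ 2) - ε : ℝ) : ℂ))‖ ≤ ‖z‖ := by
  rw [norm_regMod z ε, sub_le_iff_le_add, Real.sqrt_le_left (by positivity)]
  nlinarith [norm_nonneg z, hε.le]

/-- `Φ_ε → |ψ|` pointwise as `ε = 1/(n+1) → 0`, in the `ℝ≥0∞`-squared form used under the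
integral. [folklore] -/
theorem tendsto_nnnorm_regMod_sq (z : ℂ) :
    Tendsto (fun n : ℕ => ((‖(((Real.sqrt (‖z‖ ^ 2 + (1 / ((n : ℝ) + 1)) ^ 2) -
      1 / ((n : ℝ) + 1) : ℝ) : ℂ))‖₊ : ℝ≥0∞)) ^ 2) atTop (𝓝 (((‖z‖₊ : ℝ≥0∞)) ^ 2)) := by
  have hε : Tendsto (fun n : ℕ => 1 / ((n : ℝ) + 1)) atTop (𝓝 0) :=
    tendsto_one_div_add_atTop_nhds_zero_nat
  have h1 : Tendsto (fun n : ℕ => Real.sqrt (‖z‖ ^ 2 + (1 / ((n : ℝ) + 1)) ^ 2) - 1 / ((n : ℝ) + 1))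
      atTop (𝓝 ‖z‖) := by
    have h := ((Real.continuous_sqrt.tendsto _).comp
      ((hε.pow 2).const_add (‖z‖ ^ 2))).sub hε
    simp only [ne_eq, OfNat.ofNat_ne_zero, not_false_eq_true, zero_pow, add_zero, sub_zero,
      Real.sqrt_sq (norm_nonneg z)] at h
    exact h
  have h2 : Tendsto (fun n : ℕ => ‖(((Real.sqrt (‖z‖ ^ 2 + (1 / ((n : ℝ) + 1)) ^ 2) -
      1 / ((n : ℝ) + 1) : ℝ) : ℂ))‖ ^ 2) atTop (𝓝 (‖z‖ ^ 2)) := by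
    exact (h1.pow 2).congr fun n => by rw [norm_regMod]
  simp only [coe_nnnorm_sq_eq_ofReal]
  exact (ENNReal.continuous_ofReal.tendsto _).comp h2

/-- **The derivative of `Φ_ε`**: `∂_d Φ_ε = Re(∂_dψ · ψ̄)/√(|ψ|² + ε²)`, so
`|∂_d Φ_ε| = |Re(∂_dψ · ψ̄)| / √(|ψ|² + ε²)`. [folklore] -/
theorem norm_fderiv_regMod {ψ : Config N → ℂ} (hψ : Differentiable ℝ ψ) {ε : ℝ} (hε : 0 < ε)
    (X d : Config N) :
    ‖fderiv ℝ (fun Y => ((Real.sqrt (‖ψ Y‖ ^ 2 + ε ^ 2) - ε : ℝ) : ℂ)) X d‖ =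
      |(fderiv ℝ ψ X d * conj (ψ X)).re| / Real.sqrt (‖ψ X‖ ^ 2 + ε ^ 2) := by
  have hpos : 0 < ‖ψ X‖ ^ 2 + ε ^ 2 := by positivity
  have hs : 0 < Real.sqrt (‖ψ X‖ ^ 2 + ε ^ 2) := Real.sqrt_pos.2 hpos
  have h0 := (((hψ X).hasFDerivAt.norm_sq.add_const (ε ^ 2)).sqrt hpos.ne').sub_const ε
  have h : HasFDerivAt (fun Y => ((Real.sqrt (‖ψ Y‖ ^ 2 + ε ^ 2) - ε : ℝ) : ℂ)) _ X :=
    Complex.ofRealCLM.hasFDerivAt.comp X h0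
  rw [h.fderiv]
  simp only [ContinuousLinearMap.comp_apply, _root_.smul_apply,
    Complex.ofRealCLM_apply, innerSL_apply_apply, Complex.inner, Complex.norm_real,
    Real.norm_eq_abs, smul_eq_mul, nsmul_eq_mul, Nat.cast_ofNat]
  rw [show (1 : ℝ) / (2 * Real.sqrt (‖ψ X‖ ^ 2 + ε ^ 2)) * (2 * (fderiv ℝ ψ X d * conj (ψ X)).re) =
      (fderiv ℝ ψ X d * conj (ψ X)).re / Real.sqrt (‖ψ X‖ ^ 2 + ε ^ 2) by field_simp]
  rw [abs_div, abs_of_pos hs]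

/-! ### The pointwise diamagnetic / centre-of-mass inequality -/

/-- **`|∇Ψ|² ≥ |∇Φ_ε|² + (|q|²/N)|Ψ|²` pointwise** for a differentiable `Ψ` of total momentum `q`
(`N ≥ 1`, `ε > 0`, `Φ_ε = √(|Ψ|²+ε²) − ε`). [folklore] -/
theorem kineticDensity_regMod_add_le (hN : 0 < N) {q : Space} {ψ : Config N → ℂ}
    (hq : HasTotalMomentum q ψ) (hψ : Differentiable ℝ ψ) {ε : ℝ} (hε : 0 < ε) (X : Config N) :
    kineticDensity (fun Y => ((Real.sqrt (‖ψ Y‖ ^ 2 + ε ^ 2) - ε : ℝ) : ℂ)) X +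
        ENNReal.ofReal (‖q‖ ^ 2 / N) * ((‖ψ X‖₊ : ℝ≥0∞) ^ 2) ≤ kineticDensity ψ X := by
  set w : Fin N → Fin 3 → ℂ := fun i a => fderiv ℝ ψ X (Pi.single i (EuclideanSpace.single a 1))
    with hw
  have hmom : ∀ a, ∑ i, w i a = (q a : ℂ) * Complex.I * ψ X := fun a =>
    hq.sum_fderiv_apply_single hψ X a
  have halg := cm_diamagnetic_alg hN (ψ X) w q hmom ε
  have hs2 : Real.sqrt (‖ψ X‖ ^ 2 + ε ^ 2) ^ 2 = ‖ψ X‖ ^ 2 + ε ^ 2 :=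
    Real.sq_sqrt (by positivity)
  -- the three pieces as `ofReal`
  have hkinΦ : kineticDensity (fun Y => ((Real.sqrt (‖ψ Y‖ ^ 2 + ε ^ 2) - ε : ℝ) : ℂ)) X =
      ENNReal.ofReal ((∑ i, ∑ a, ((w i a * conj (ψ X)).re) ^ 2) / (‖ψ X‖ ^ 2 + ε ^ 2)) := by
    unfold kineticDensity
    simp only [coe_nnnorm_sq_eq_ofReal, norm_fderiv_regMod hψ hε, div_pow, sq_abs, hs2]
    rw [sum_sum_ofReal _ fun i a => by positivity, Finset.sum_div]
    exact congrArg _ (Finset.sum_congr rfl fun i _ => by rw [Finset.sum_div])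
  have hkinψ : kineticDensity ψ X = ENNReal.ofReal (∑ i, ∑ a, ‖w i a‖ ^ 2) := by
    unfold kineticDensity
    simp only [coe_nnnorm_sq_eq_ofReal, hw]
    exact sum_sum_ofReal _ fun i a => by positivity
  have hq2 : ‖q‖ ^ 2 = ∑ a, q a ^ 2 := EuclideanSpace.real_norm_sq_eq q
  rw [hkinΦ, hkinψ, coe_nnnorm_sq_eq_ofReal, ← ENNReal.ofReal_mul (by positivity),
    ← ENNReal.ofReal_add (by positivity) (by positivity), hq2]
  exact ENNReal.ofReal_le_ofReal halg

/-! ### The sector floor `E^per_N(q;L) ≥ E₀^per(N,L) + |q|²/N` -/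

/-- **One `ε`**: for an admissible Bloch-`q` state `Ψ` (`N ≥ 1`) and `ε > 0`,
`E₀^per · ∫_{cell}|Φ_ε|² + |q|²/N ≤ ⟨Ψ, HΨ⟩`. [folklore] -/
theorem mul_lintegral_regMod_add_le (hN : 0 < N) (v : ℝ → ℝ≥0∞) {q : Space}
    (Ψ : PeriodicTrialState N L) (hq : HasTotalMomentum q Ψ.ψ) {ε : ℝ} (hε : 0 < ε) :
    periodicGroundStateEnergy v N L *
        (∫⁻ X in cellN N L, ((‖(((Real.sqrt (‖Ψ.ψ X‖ ^ 2 + ε ^ 2) - ε : ℝ) : ℂ))‖₊ : ℝ≥0∞)) ^ 2) +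
      ENNReal.ofReal (‖q‖ ^ 2 / N) ≤ periodicEnergy v Ψ := by
  set Φ : Config N → ℂ := fun Y => ((Real.sqrt (‖Ψ.ψ Y‖ ^ 2 + ε ^ 2) - ε : ℝ) : ℂ) with hΦ
  have hd : Differentiable ℝ Ψ.ψ := Ψ.contDiff.differentiable one_ne_zero
  have hC : ContDiff ℝ 1 Φ := contDiff_regMod Ψ.contDiff hε
  have hper : ∀ (X : Config N) (i : Fin N) (k : Fin 3),
      Φ (X + Pi.single i (EuclideanSpace.single k L)) = Φ X := by
    intro X i k; simp only [hΦ, Ψ.periodic]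
  have hsymm : ∀ (σ : Equiv.Perm (Fin N)) (X : Config N), Φ (X ∘ σ) = Φ X := by
    intro σ X; simp only [hΦ, Ψ.symm]
  -- `∫|Φ_ε|² ≤ ∫|Ψ|² = 1 < ⊤`
  have hle : ∀ X, ((‖Φ X‖₊ : ℝ≥0∞)) ^ 2 ≤ ((‖Ψ.ψ X‖₊ : ℝ≥0∞)) ^ 2 := by
    intro X
    gcongr
    rw [← NNReal.coe_le_coe, coe_nnnorm, coe_nnnorm]
    exact norm_regMod_le (Ψ.ψ X) hε
  have htop : ∫⁻ X in cellN N L, ((‖Φ X‖₊ : ℝ≥0∞)) ^ 2 ≠ ⊤ := by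
    refine ne_top_of_le_ne_top ?_ (lintegral_mono fun X => hle X)
    rw [Ψ.norm_eq]; exact ENNReal.one_ne_top
  -- the unnormalised variational principle for `Φ_ε`
  have hvar := periodicGroundStateEnergy_mul_lintegral_le v hC hper hsymm htop
  -- pointwise: `(kin Φ + V|Φ|²) + c|Ψ|² ≤ kin Ψ + V|Ψ|²`
  have hpt : ∀ X, (kineticDensity Φ X + periodicInteraction v L X * ((‖Φ X‖₊ : ℝ≥0∞)) ^ 2) +
      ENNReal.ofReal (‖q‖ ^ 2 / N) * ((‖Ψ.ψ X‖₊ : ℝ≥0∞)) ^ 2 ≤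
      kineticDensity Ψ.ψ X + periodicInteraction v L X * ((‖Ψ.ψ X‖₊ : ℝ≥0∞)) ^ 2 := by
    intro X
    calc (kineticDensity Φ X + periodicInteraction v L X * ((‖Φ X‖₊ : ℝ≥0∞)) ^ 2) +
          ENNReal.ofReal (‖q‖ ^ 2 / N) * ((‖Ψ.ψ X‖₊ : ℝ≥0∞)) ^ 2
        = (kineticDensity Φ X + ENNReal.ofReal (‖q‖ ^ 2 / N) * ((‖Ψ.ψ X‖₊ : ℝ≥0∞)) ^ 2) +
            periodicInteraction v L X * ((‖Φ X‖₊ : ℝ≥0∞)) ^ 2 := by ring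
      _ ≤ kineticDensity Ψ.ψ X + periodicInteraction v L X * ((‖Ψ.ψ X‖₊ : ℝ≥0∞)) ^ 2 :=
          add_le_add (kineticDensity_regMod_add_le hN hq hd hε X)
            (mul_le_mul_of_nonneg_left (hle X) (by positivity))
  calc periodicGroundStateEnergy v N L * (∫⁻ X in cellN N L, ((‖Φ X‖₊ : ℝ≥0∞)) ^ 2) +
        ENNReal.ofReal (‖q‖ ^ 2 / N)
      ≤ (∫⁻ X in cellN N L, (kineticDensity Φ X +
            periodicInteraction v L X * ((‖Φ X‖₊ : ℝ≥0∞)) ^ 2)) +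
          ∫⁻ X in cellN N L, ENNReal.ofReal (‖q‖ ^ 2 / N) * ((‖Ψ.ψ X‖₊ : ℝ≥0∞)) ^ 2 := by
        rw [lintegral_const_mul' _ _ ENNReal.ofReal_ne_top, Ψ.norm_eq, mul_one]
        exact add_le_add hvar le_rfl
    _ ≤ ∫⁻ X in cellN N L, ((kineticDensity Φ X +
            periodicInteraction v L X * ((‖Φ X‖₊ : ℝ≥0∞)) ^ 2) +
          ENNReal.ofReal (‖q‖ ^ 2 / N) * ((‖Ψ.ψ X‖₊ : ℝ≥0∞)) ^ 2) := le_lintegral_add _ _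
    _ ≤ periodicEnergy v Ψ := lintegral_mono fun X => hpt X

/-- **The sector floor `E₀^per(N,L) + |q|²/N ≤ E^per_N(q;L)`** for every `v : ℝ → ℝ≥0∞`, every
`N ≥ 1`, every `L` and every `q ∈ ℝ³` (the inequality half of the Galilei splitting
`H = P²/(2mN) + H_rel` on the torus; `2m = 1`). The limit `ε → 0` in `mul_lintegral_regMod_add_le`
by dominated convergence (`|Φ_ε|² ≤ |Ψ|²`, `∫|Ψ|² = 1`). [folklore] -/
theorem periodicGroundStateEnergy_add_le_momentumSectorEnergy (hN : 0 < N) (v : ℝ → ℝ≥0∞)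
    (L : ℝ) (q : Space) :
    periodicGroundStateEnergy v N L + ENNReal.ofReal (‖q‖ ^ 2 / N) ≤
      momentumSectorEnergy v N L q := by
  refine le_iInf₂ fun Ψ hq => ?_
  -- the masses `m_n = ∫|Φ_{1/(n+1)}|²`
  set F : ℕ → Config N → ℝ≥0∞ := fun n X => ((‖(((Real.sqrt (‖Ψ.ψ X‖ ^ 2 +
    (1 / ((n : ℝ) + 1)) ^ 2) - 1 / ((n : ℝ) + 1) : ℝ) : ℂ))‖₊ : ℝ≥0∞)) ^ 2 with hF
  have hεn : ∀ n : ℕ, (0 : ℝ) < 1 / ((n : ℝ) + 1) := fun n => Nat.one_div_pos_of_nat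
  have hFmeas : ∀ n, Measurable (F n) := by
    intro n
    have hc : Continuous fun X => ((Real.sqrt (‖Ψ.ψ X‖ ^ 2 + (1 / ((n : ℝ) + 1)) ^ 2) -
        1 / ((n : ℝ) + 1) : ℝ) : ℂ) := (contDiff_regMod Ψ.contDiff (hεn n)).continuous
    exact (hc.measurable.nnnorm.coe_nnreal_ennreal).pow_const _
  have hFle : ∀ n, F n ≤ᵐ[volume.restrict (cellN N L)] fun X => ((‖Ψ.ψ X‖₊ : ℝ≥0∞)) ^ 2 := by
    intro n
    refine Filter.Eventually.of_forall fun X => ?_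
    simp only [hF]
    gcongr
    rw [← NNReal.coe_le_coe, coe_nnnorm, coe_nnnorm]
    exact norm_regMod_le (Ψ.ψ X) (hεn n)
  have hfin : ∫⁻ X in cellN N L, ((‖Ψ.ψ X‖₊ : ℝ≥0∞)) ^ 2 ≠ ⊤ := by
    rw [Ψ.norm_eq]; exact ENNReal.one_ne_top
  have hlim : ∀ᵐ X ∂(volume.restrict (cellN N L)),
      Tendsto (fun n => F n X) atTop (𝓝 (((‖Ψ.ψ X‖₊ : ℝ≥0∞)) ^ 2)) :=
    Filter.Eventually.of_forall fun X => tendsto_nnnorm_regMod_sq (Ψ.ψ X)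
  have hmass : Tendsto (fun n => ∫⁻ X in cellN N L, F n X) atTop (𝓝 1) := by
    rw [← Ψ.norm_eq]
    exact tendsto_lintegral_of_dominated_convergence _ hFmeas hFle hfin hlim
  -- pass to the limit in `E₀ m_n + |q|²/N ≤ ⟨Ψ,HΨ⟩`
  have hconv : Tendsto (fun n => periodicGroundStateEnergy v N L * (∫⁻ X in cellN N L, F n X) +
      ENNReal.ofReal (‖q‖ ^ 2 / N)) atTop
      (𝓝 (periodicGroundStateEnergy v N L * 1 + ENNReal.ofReal (‖q‖ ^ 2 / N))) :=
    Tendsto.add_const _ (ENNReal.Tendsto.const_mul hmass (Or.inl one_ne_zero))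
  rw [mul_one] at hconv
  exact le_of_tendsto' hconv fun n => mul_lintegral_regMod_add_le hN v Ψ hq (hεn n)

/-! ### Finiteness of `E₀^per` -/

/-- **`E₀^per(N, L) < ⊤` for an integrable potential** (`L > 0`): the constant state has energy
`C(N,2) L⁻³ ∫v < ∞` (`N ≥ 2`, `IMUChainGlue.periodicGroundStateEnergy_le_pairs`); `E₀^per = 0` for
`N ≤ 1`. [folklore] -/
theorem periodicGroundStateEnergy_ne_top_of_lintegral_ne_top {v : ℝ → ℝ≥0∞} (hv : Measurable v)
    (hint : (∫⁻ x : Space, v ‖x‖) ≠ ⊤) (N : ℕ) (hL : 0 < L) :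
    periodicGroundStateEnergy v N L ≠ ⊤ := by
  rcases N with _ | _ | m
  · -- `N = 0`: the constant state `1` on the one-point configuration space
    let Φ : PeriodicTrialState 0 L :=
      { ψ := fun _ => 1
        contDiff := contDiff_const
        periodic := fun _ i _ => Fin.elim0 i
        symm := fun _ _ => rfl
        norm_eq := by
          rw [setLIntegral_const, volume_cellN]
          simp }
    refine ne_top_of_le_ne_top (b := periodicEnergy v Φ) ?_ (periodicGroundStateEnergy_le v Φ)
    have h0 : periodicEnergy v Φ = 0 := by
      refine (lintegral_congr fun X => ?_).trans lintegral_zero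
      simp [kineticDensity, periodicInteraction, Φ]
    rw [h0]; exact ENNReal.zero_ne_top
  · show periodicGroundStateEnergy v 1 L ≠ ⊤
    rw [periodicGroundStateEnergy_one hL]
    exact ENNReal.zero_ne_top
  · refine ne_top_of_le_ne_top ?_ (IMUChainGlue.periodicGroundStateEnergy_le_pairs hL hv m)
    refine ENNReal.mul_ne_top (ENNReal.natCast_ne_top _) (ENNReal.mul_ne_top ?_ hint)
    refine ENNReal.inv_ne_top.2 (pow_ne_zero _ ?_)
    simpa using hL

/-! ### The zero-momentum gap -/

/-- **The zero-momentum gap at fixed `(N, L)`** in the tree's vocabulary: for measurable `v ≥ 0` with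
`∫_{ℝ³} v(|x|)dx < ∞`, every `N`, every `L > 0` and every `q ≠ 0`,
`E₀^per(N, L) < momentumSectorEnergy v N L q` — by `E^per_N(q;L) ≥ E₀^per + |q|²/N` (`N ≥ 1`) and
`E₀^per < ⊤`; `N = 0`: empty sector (`PeriodicIRBound.Negative.momentumSectorEnergy_zero_particles`).
Finite range is not needed. [folklore] -/
theorem periodicGroundStateEnergy_lt_momentumSectorEnergy {v : ℝ → ℝ≥0∞} (hv : Measurable v)
    (hint : (∫⁻ x : Space, v ‖x‖) ≠ ⊤) (N : ℕ) (hL : 0 < L) {q : Space} (hq : q ≠ 0) :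
    periodicGroundStateEnergy v N L < momentumSectorEnergy v N L q := by
  have hE := periodicGroundStateEnergy_ne_top_of_lintegral_ne_top hv hint N hL
  rcases Nat.eq_zero_or_pos N with rfl | hN
  · rw [PeriodicIRBound.Negative.momentumSectorEnergy_zero_particles v L hq]
    exact hE.lt_top
  · refine lt_of_lt_of_le ?_ (periodicGroundStateEnergy_add_le_momentumSectorEnergy hN v L q)
    refine ENNReal.lt_add_right hE ?_
    have hNpos : (0 : ℝ) < N := by exact_mod_cast hN
    have hqpos : 0 < ‖q‖ := norm_pos_iff.2 hq
    exact (ENNReal.ofReal_pos.2 (by positivity)).ne'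

end Summit.AtomisticToContinuum.BoseEinsteinCondensation.Theorems.ZeroMomentumGround

namespace Summit.AtomisticToContinuum.BoseEinsteinCondensation.Theorems

open Literature.MathematicalPhysics.QuantumManyBody.BoseGas

/-- **Item `ZeroMomentumGround` of route `BECFeynmanVortexArea` (stmt-AtomisticToContinuum-11845),
proved**: for every repulsive finite-range `v` with `∫v(|x|)dx < ∞`, every `N`, every `L > 0` and every
`q ≠ 0`, `E₀^per(N,L) < E^per_N(q;L)` (the inlined infimum is `momentumSectorEnergy v N L q` by
`rfl`). Proof: diamagnetic + centre-of-mass floor `E^per_N(q;L) ≥ E₀^per + |q|²/N`, finiteness of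
`E₀^per` by the constant state, emptiness of the `N = 0` sectors. [folklore] -/
theorem zeroMomentumGround_proof :
    Summit.AtomisticToContinuum.BoseEinsteinCondensation.Theses.BECFeynmanVortexArea.ZeroMomentumGround := by
  intro v hv hint N L hL q hq
  exact ZeroMomentumGround.periodicGroundStateEnergy_lt_momentumSectorEnergy hv.1 hint N hL hq

/-- **The same item as wanted by route `BECNoCheapMomentum`** (identical statement text).
[folklore] -/
theorem zeroMomentumGround_proof_noCheapMomentum :
    Summit.AtomisticToContinuum.BoseEinsteinCondensation.Theses.BECNoCheapMomentum.ZeroMomentumGround := by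
  intro v hv hint N L hL q hq
  exact ZeroMomentumGround.periodicGroundStateEnergy_lt_momentumSectorEnergy hv.1 hint N hL hq

end Summit.AtomisticToContinuum.BoseEinsteinCondensation.Theorems

end
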